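import Literature.Probability.Percolation.BergKahnLogSupermodular
import Literature.Probability.Percolation.FourFunctionsProdBernoulli
import HarnessLib

/-!
# Ahlswede–Daykin four events under avoidance conditioning: van den Berg–Häggström–Kahn's induction for arbitrary
# SOURCE-LOCAL events ("cross-conditioning exchanges")   (PAPER-2 track (ii); seat `prim-consts-2`, gen 19)

builds on p205010 (kernel theorem, internal audit signed; external expert review pending).  Support file
(`--supports stmt-CriticalPhenomena-4575`); memo `run/shared/lean/prim/consts/FROM-prim-consts-2-g19-RIDER-EXCHANGE.md`.
Two bookkeeping `def`s (the reach profile of a source set, and the event that it lies in a prescribed family — exactly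
parallel to the tree's `BergKahn.reachFam` for one source), theorems; no sorries; standard axioms.

THE PRINCIPLE.  Let `S₁, S₂` be finite source sets, `Φ₁, …, Φ₄` predicates on reach profiles (`v ↦` the set of vertices
joined to `v`, for `v` in the source set), and suppose the plain Ahlswede–Daykin hypothesis holds:
for all configurations `ω, ω'`, if the `S₁`-profile of `ω` satisfies `Φ₁` and the `S₂`-profile of `ω'` satisfies `Φ₂`, then the
`S₁ ∩ S₂`-profile of the MEET `ω ∩ ω'` satisfies `Φ₃` and the `S₁ ∪ S₂`-profile of the JOIN `ω ∪ ω'` satisfies `Φ₄`.  Then for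
all vertex sets `X, Y` (`μ = prodBernoulli w`, `{S ↮ W}` = no open path from a vertex of `S` to a vertex of `W`):

  `μ(Φ₁ ∩ {S₁ ↮ X}) · μ(Φ₂ ∩ {S₂ ↮ Y}) ≤ μ(Φ₃ ∩ {S₁ ∩ S₂ ↮ X ∪ Y}) · μ(Φ₄ ∩ {S₁ ∪ S₂ ↮ X ∩ Y})`

(`Consts.localEv_fourEvents`).  For `X ∩ Y = ∅` this is the four functions theorem for the product measure
(`prodBernoulli_fourEvents`): avoidance events are decreasing and pass to the meet.  The point is the JOIN side: the union
`ω ∪ ω'` may well join a source to `X ∩ Y`, yet the inequality survives with `{S₁ ∪ S₂ ↮ X ∩ Y}` there — by van den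
Berg–Häggström–Kahn's induction (their proof of Thm. 1.1, run here verbatim for source-local events; tree:
`BergKahn.bhk_aux`): condition on the set `𝐒` of vertices with an open edge into `Z = X ∩ Y` (a product law, log-modular),
observe that on `{S ↮ Z}` every source-local event is the same event for percolation restricted to `V ∖ Z` with `Z` replaced
by `𝐒` (`Consts.localEv_fibre`), and apply the four functions theorem on the lattice of boundary sets with the induction
hypothesis.  Special cases in the tree: `BergKahn.bhk_thm_1_1` (`S₁ = S₂ = {s}`, `Φ₃ = ⊤`), `BergKahn.bergKahn_groupAvoidance`
(`Φᵢ = ⊤`), `Consts.twoSource_twoSet` at indicators.  NEW instances (the "exchange with a rider" inequalities (F1), (F1_U) of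
memo FROM-prim-consts-2-g18-XEDGE-CROSS.md addendum (8),(11), which are the up-set atoms of the CROSS member `M₂` at `u = z`
and are NOT same-conditioning exchanges — the two left factors live in `{y ↮ s}` and `{s ↔ y}`):
* `Consts.crossExchange` (F1, two-set form):
  `μ(y↔z, y↮{s}∪X, s↮X) · μ(s↔y, s↮Y∪{z}) ≤ μ(y↮{s,z}∪X∪Y, s↮X∪Y∪{z}) · μ(s↔y, s↔z, s↮X∩Y)`;
* `Consts.crossExchange_upset` (F1_U): the same with an arbitrary increasing event `{V(C_s) ∈ 𝒰}` of the cluster of `s`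
  riding on the second and the fourth factor.
[cite: VandenbergHaggstromKahn2005, Thm. 1.1 and its proof (pp. 3–5), eq. (4)] [cite: VandenbergKahn2001, §3 (pp. 124–126)]
[cite: BollobasRiordan2006, Ch. 2 Thm. 7 and eq. (14)]
-/

noncomputable section

namespace Summit.CriticalPhenomena.PercolationContinuityZ3.Theorems

open MeasureTheory SimpleGraph Finset
open Literature.Probability.LatticeModels (prodBernoulli prodBernoulli_real_inter_biInter_of_determinedBy)
open Literature.Probability.Percolation Literature.Probability.Percolation.BergKahn
open Literature.Computation.FiniteGraph (measurableSet_of_fintype)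

namespace Consts

variable {V : Type}

/-! ### Reach profiles and source-local events -/

/-- The reach profile of a source set `S` in the configuration `ω`: `v ↦ {u | v ↔ u}` for `v ∈ S` (and `∅` off `S`).
[cite: VandenbergHaggstromKahn2005, §1 p. 3 (events determined by the open cluster of `s`)] -/
def reachOf (S : Finset V) (ω : BondConfig V) : V → Set V := fun v => {u | v ∈ S ∧ (openGraph ω).Reachable v u}

/-- The **source-local event** `{Φ(reach profile of S)}` for percolation restricted to the vertex set `U` (only edges with both
endpoints in `U` are used). [cite: VandenbergHaggstromKahn2005, §1 p. 4 (the induced model on `G ∖ Z`)] -/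
def localEv (U S : Finset V) (Φ : (V → Set V) → Prop) : Set (BondConfig V) := {ω | Φ (reachOf S (ω ∩ edgesIn U))}

/-- Membership in a source-local event. [folklore] -/
theorem mem_localEv {U S : Finset V} {Φ : (V → Set V) → Prop} {ω : BondConfig V} :
    ω ∈ localEv U S Φ ↔ Φ (reachOf S (ω ∩ edgesIn U)) := Iff.rfl

/-- The reach profile inside `U` in terms of `BergKahn.ReachIn`. [folklore] -/
theorem reachOf_restrict (U S : Finset V) (ω : BondConfig V) :
    reachOf S (ω ∩ edgesIn U) = fun v => {u | v ∈ S ∧ ReachIn U ω v u} := rfl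

/-- A source-local event inside `U` only depends on the edges inside `U`. [folklore] -/
theorem determinedBy_localEv (U S : Finset V) (Φ : (V → Set V) → Prop) : DeterminedBy (localEv U S Φ) (edgesIn U) := by
  rw [determinedBy_iff]
  intro ω ω' h
  simp only [localEv, Set.mem_setOf_eq, h]

/-- `s(u,v)` lies inside `U` iff both endpoints do. [folklore] -/
private theorem mk_mem_edgesIn' {U : Finset V} {u v : V} : s(u, v) ∈ edgesIn U ↔ u ∈ U ∧ v ∈ U := by
  simp [edgesIn, Sym2.mem_iff]

/-- Adjacency in the open graph restricted to `U`. [folklore] -/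
private theorem adj_iff' {U : Finset V} {ω : BondConfig V} {u v : V} :
    (openGraph (ω ∩ edgesIn U)).Adj u v ↔ s(u, v) ∈ ω ∧ u ∈ U ∧ v ∈ U ∧ u ≠ v := by
  rw [openGraph, fromEdgeSet_adj, Set.mem_inter_iff, mk_mem_edgesIn']; tauto

variable [DecidableEq V]

/-- On `{s ↛ Z inside U}`, reaching a vertex inside `U` is reaching it inside `U ∖ Z`. [cite: VandenbergKahn2001, §3 eq. (4)] -/
private theorem reachIn_sdiff_of_avoid' (U Z : Finset V) {s : V} {ω : BondConfig V}
    (hZ : ω ∈ avoidIn U s ↑Z) {a : V} (ha : ReachIn U ω s a) : ReachIn (U \ Z) ω s a := by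
  rw [ReachIn, reachable_iff_reflTransGen] at ha
  induction ha with
  | refl => exact Reachable.refl _
  | tail hab hbc ih =>
    rename_i b c
    obtain ⟨he, hbU, hcU, hne⟩ := adj_iff'.mp hbc
    have hbZ : b ∉ Z := fun hbZ => hZ b (mem_coe.mpr hbZ) ((reachable_iff_reflTransGen _ _).mpr hab)
    have hcZ : c ∉ Z := fun hcZ => hZ c (mem_coe.mpr hcZ) ((reachable_iff_reflTransGen _ _).mpr (hab.tail hbc))
    exact ih.trans (adj_iff'.mpr ⟨he, mem_sdiff.mpr ⟨hbU, hbZ⟩, mem_sdiff.mpr ⟨hcU, hcZ⟩, hne⟩).reachable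

/-- On `{S ↛ Z inside U}` the reach profile of `S` inside `U` equals the one inside `U ∖ Z`. [cite: VandenbergKahn2001, §3 eq. (4)] -/
theorem reachOf_eq_of_avoid (U Z S : Finset V) {ω : BondConfig V} (hZ : ω ∈ avoidInS U S ↑Z) :
    reachOf S (ω ∩ edgesIn U) = reachOf S (ω ∩ edgesIn (U \ Z)) := by
  funext v
  ext u
  simp only [reachOf, Set.mem_setOf_eq]
  constructor
  · rintro ⟨hv, hr⟩
    exact ⟨hv, reachIn_sdiff_of_avoid' U Z (fun x hx => hZ v hv x hx) hr⟩
  · rintro ⟨hv, hr⟩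
    have hsub : edgesIn (U \ Z) ⊆ edgesIn U := fun e he x hx => (mem_sdiff.mp ((he : ∀ v ∈ e, v ∈ U \ Z) x hx)).1
    exact ⟨hv, Reachable.mono (fromEdgeSet_mono (Set.inter_subset_inter_right _ hsub)) hr⟩

/-- **The fibre identity for a source-local event**: on `{𝐒 = T}`, `Φ ∩ {S ↛ W ∪ Z}` inside `U` is `Φ ∩ {S ↛ W ∪ T}` inside
`U ∖ Z` (`Z ⊆ U`, `S ⊆ U ∖ Z`). [cite: VandenbergHaggstromKahn2005, proof of Thm. 1.1, eq. (4) (p. 4)] -/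
theorem localEv_fibre (U Z : Finset V) (hZU : Z ⊆ U) {S : Finset V} (hS : S ⊆ U \ Z) (Φ : (V → Set V) → Prop)
    (W : Set V) (T : Finset V) :
    localEv U S Φ ∩ avoidInS U S (W ∪ ↑Z) ∩ {ω | bS U Z ω = T} =
      localEv (U \ Z) S Φ ∩ avoidInS (U \ Z) S (W ∪ ↑T) ∩ {ω | bS U Z ω = T} := by
  have h := fibre_eqS U Z hZU hS W T
  ext ω
  constructor
  · rintro ⟨⟨hQ, hR⟩, hT⟩
    have h' : ω ∈ avoidInS (U \ Z) S (W ∪ ↑T) ∩ {ω | bS U Z ω = T} := by rw [← h]; exact ⟨hR, hT⟩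
    have hRZ : ω ∈ avoidInS U S ↑Z := avoidInS_anti U S Set.subset_union_right hR
    refine ⟨⟨?_, h'.1⟩, hT⟩
    rw [mem_localEv] at hQ ⊢
    rwa [← reachOf_eq_of_avoid U Z S hRZ]
  · rintro ⟨⟨hQ, hR⟩, hT⟩
    have h' : ω ∈ avoidInS U S (W ∪ ↑Z) ∩ {ω | bS U Z ω = T} := by rw [h]; exact ⟨hR, hT⟩
    have hRZ : ω ∈ avoidInS U S ↑Z := avoidInS_anti U S Set.subset_union_right h'.1
    refine ⟨⟨?_, h'.1⟩, hT⟩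
    rw [mem_localEv] at hQ ⊢
    rwa [reachOf_eq_of_avoid U Z S hRZ]

/-! ### The law of `𝐒` and the independence of the inside (as in `BergKahnLogSupermodular`, whose versions are file-private) -/

/-- Membership in `𝐒`. [folklore] -/
private theorem mem_bS' (U Z : Finset V) {ω : BondConfig V} {y : V} : y ∈ bS U Z ω ↔ y ∈ U \ Z ∧ touch Z ω y := by
  classical simp only [bS, mem_filter]

/-- `{𝐒 = T}` is the intersection of the one-vertex fibre events (`T ⊆ U ∖ Z`). [folklore] -/
private theorem fibre_eq_iInter' (U Z : Finset V) {T : Finset V} (hT : T ⊆ U \ Z) :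
    {ω | bS U Z ω = T} = ⋂ y ∈ U \ Z, fibreEv Z T y := by
  ext ω
  simp only [Set.mem_setOf_eq, Set.mem_iInter]
  constructor
  · intro h y hy
    unfold fibreEv
    split_ifs with hyT
    · exact ((mem_bS' U Z).mp (h ▸ hyT)).2
    · intro ht; exact hyT (h ▸ (mem_bS' U Z).mpr ⟨hy, ht⟩)
  · intro h
    ext y
    rw [mem_bS']
    constructor
    · rintro ⟨hy, ht⟩
      have := h y hy
      unfold fibreEv at this
      split_ifs at this with hyT
      · exact hyT
      · exact absurd ht this
    · intro hyT
      have hy := hT hyT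
      have := h y hy
      unfold fibreEv at this
      rw [if_pos hyT] at this
      exact ⟨hy, this⟩

/-- `fibreEv Z T y` depends only on the edges from `y` into `Z`. [folklore] -/
private theorem determinedBy_fibreEv' (Z T : Finset V) (y : V) : DeterminedBy (fibreEv Z T y) ↑(edgeStar Z y) := by
  rw [determinedBy_iff]
  intro ω ω' h
  have key : touch Z ω y ↔ touch Z ω' y := by
    simp only [touch]
    constructor
    · rintro ⟨z, hz, hyz⟩
      have : s(y, z) ∈ ω ∩ ↑(edgeStar Z y) := ⟨hyz, mem_coe.mpr (mem_image.mpr ⟨z, hz, rfl⟩)⟩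
      rw [h] at this; exact ⟨z, hz, this.1⟩
    · rintro ⟨z, hz, hyz⟩
      have : s(y, z) ∈ ω' ∩ ↑(edgeStar Z y) := ⟨hyz, mem_coe.mpr (mem_image.mpr ⟨z, hz, rfl⟩)⟩
      rw [← h] at this; exact ⟨z, hz, this.1⟩
  unfold fibreEv
  split_ifs <;> simp only [Set.mem_setOf_eq, key]

/-- The edge stars of distinct vertices outside `Z` are disjoint. [folklore] -/
private theorem pairwiseDisjoint_edgeStar' (U Z : Finset V) : (↑(U \ Z) : Set V).PairwiseDisjoint (edgeStar Z) := by
  intro y hy y' hy' hne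
  rw [Function.onFun, Finset.disjoint_left]
  intro e he he'
  obtain ⟨z, hz, rfl⟩ := mem_image.mp he
  obtain ⟨z', hz', h⟩ := mem_image.mp he'
  rcases Sym2.eq_iff.mp h with ⟨h1, _⟩ | ⟨h1, h2⟩
  · exact hne h1.symm
  · exact (mem_sdiff.mp (mem_coe.mp hy)).2 (h2 ▸ hz')

/-- The edges inside `U ∖ Z` avoid every edge star into `Z`. [folklore] -/
private theorem edgesIn_subset_compl' (U Z : Finset V) :
    edgesIn (U \ Z) ⊆ (⋃ y ∈ U \ Z, (↑(edgeStar Z y) : Set (Sym2 V)))ᶜ := by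
  intro e he hmem
  simp only [Set.mem_iUnion, mem_coe, exists_prop] at hmem
  obtain ⟨y, _, hy⟩ := hmem
  obtain ⟨z, hz, rfl⟩ := mem_image.mp hy
  exact (mem_sdiff.mp ((mk_mem_edgesIn'.mp he).2)).2 hz

variable [Fintype V] (w : Sym2 V → unitInterval)

omit [Fintype V] in
/-- `π ≥ 0`. [folklore] -/
private theorem piS_nonneg' (U Z : Finset V) (T : Finset V) : 0 ≤ piS U Z w T :=
  prod_nonneg fun _ _ => measureReal_nonneg

/-- **Independence of the inside from the edges at `Z`, for a source-local event**:
`P(Φ ∩ {S ↛ W ∪ Z in U} ∩ {𝐒 = T}) = P(Φ ∩ {S ↛ W ∪ T in U ∖ Z}) · π(T)`.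
[cite: VandenbergHaggstromKahn2005, proof of Thm. 1.1, eq. (4) (p. 4)] -/
theorem real_localEv_fibre (U Z : Finset V) (hZU : Z ⊆ U) {S : Finset V} (hS : S ⊆ U \ Z) (Φ : (V → Set V) → Prop)
    (W : Set V) {T : Finset V} (hT : T ⊆ U \ Z) :
    (prodBernoulli w).real (localEv U S Φ ∩ avoidInS U S (W ∪ ↑Z) ∩ {ω | bS U Z ω = T}) =
      (prodBernoulli w).real (localEv (U \ Z) S Φ ∩ avoidInS (U \ Z) S (W ∪ ↑T)) * piS U Z w T := by
  rw [localEv_fibre U Z hZU hS Φ W T, fibre_eq_iInter' U Z hT, piS]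
  exact prodBernoulli_real_inter_biInter_of_determinedBy w (U \ Z) (edgeStar Z) (pairwiseDisjoint_edgeStar' U Z)
    (fun y _ => determinedBy_fibreEv' Z T y) (fun _ _ => measurableSet_of_fintype _)
    (((determinedBy_localEv _ _ _).inter (determinedBy_avoidInS _ _ _)).mono (edgesIn_subset_compl' U Z))
    (measurableSet_of_fintype _)

/-- Summing over the fibres of `𝐒`. [folklore] -/
private theorem sum_fibre' (U Z : Finset V) (B : Set (BondConfig V)) :
    ∑ T ∈ (U \ Z).powerset, (prodBernoulli w).real (B ∩ {ω | bS U Z ω = T}) = (prodBernoulli w).real B := by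
  have h := sum_measureReal_preimage_singleton (μ := (prodBernoulli w).restrict B) (U \ Z).powerset (f := bS U Z)
    (fun T _ => measurableSet_of_fintype _)
  have hpre : bS U Z ⁻¹' (↑((U \ Z).powerset) : Set (Finset V)) = Set.univ :=
    Set.eq_univ_of_forall fun ω => mem_coe.mpr (mem_powerset.mpr fun y hy => ((mem_bS' U Z).mp hy).1)
  rw [hpre, measureReal_restrict_apply MeasurableSet.univ, Set.univ_inter] at h
  rw [← h]
  refine sum_congr rfl fun T _ => ?_
  rw [measureReal_restrict_apply (measurableSet_of_fintype _), Set.inter_comm]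
  rfl

/-! ### The induction -/

/-- **Four events under avoidance conditioning, inside `U`** (BHK's induction for source-local events): for source sets
`S₁, S₂ ⊆ U`, predicates `Φ₁, Φ₂, Φ₃, Φ₄` on reach profiles satisfying the Ahlswede–Daykin hypothesis (`Φ₁`-profile of `ω`
and `Φ₂`-profile of `ω'` ⟹ `Φ₃` for the `S₁ ∩ S₂`-profile of `ω ∩ ω'` and `Φ₄` for the `S₁ ∪ S₂`-profile of `ω ∪ ω'`, for all
configurations), and `X, Y ⊆ U`:
`P(Φ₁, S₁ ↛ X) · P(Φ₂, S₂ ↛ Y) ≤ P(Φ₃, S₁ ∩ S₂ ↛ X ∪ Y) · P(Φ₄, S₁ ∪ S₂ ↛ X ∩ Y)` (everything inside `U`).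
[cite: VandenbergHaggstromKahn2005, Thm. 1.1 and its proof (pp. 3–5) — the same induction, for source-local events; derived here] -/
theorem localEv_fourEvents_aux {S₁ S₂ : Finset V} {Φ₁ Φ₂ Φ₃ Φ₄ : (V → Set V) → Prop}
    (hAD : ∀ ω ω' : BondConfig V, Φ₁ (reachOf S₁ ω) → Φ₂ (reachOf S₂ ω') →
      Φ₃ (reachOf (S₁ ∩ S₂) (ω ∩ ω')) ∧ Φ₄ (reachOf (S₁ ∪ S₂) (ω ∪ ω'))) :
    ∀ (n : ℕ) (U : Finset V), U.card = n → S₁ ⊆ U → S₂ ⊆ U → ∀ {X Y : Finset V}, X ⊆ U → Y ⊆ U →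
    (prodBernoulli w).real (localEv U S₁ Φ₁ ∩ avoidInS U S₁ ↑X) *
        (prodBernoulli w).real (localEv U S₂ Φ₂ ∩ avoidInS U S₂ ↑Y) ≤
      (prodBernoulli w).real (localEv U (S₁ ∩ S₂) Φ₃ ∩ avoidInS U (S₁ ∩ S₂) ↑(X ∪ Y)) *
        (prodBernoulli w).real (localEv U (S₁ ∪ S₂) Φ₄ ∩ avoidInS U (S₁ ∪ S₂) ↑(X ∩ Y)) := by
  intro n
  induction n using Nat.strong_induction_on with
  | _ n ih =>
  intro U hU hS₁ hS₂ X Y hX hY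
  set μ := prodBernoulli w with hμ
  -- the AD hypothesis inside any `U'`
  have hADU : ∀ (U' : Finset V) (ω ω' : BondConfig V), ω ∈ localEv U' S₁ Φ₁ → ω' ∈ localEv U' S₂ Φ₂ →
      ω ∩ ω' ∈ localEv U' (S₁ ∩ S₂) Φ₃ ∧ ω ∪ ω' ∈ localEv U' (S₁ ∪ S₂) Φ₄ := by
    intro U' ω ω' h1 h2
    rw [mem_localEv] at h1 h2
    have h := hAD _ _ h1 h2
    rw [mem_localEv, mem_localEv, Set.union_inter_distrib_right, Set.inter_inter_distrib_right]
    exact h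
  by_cases hZe : X ∩ Y = ∅
  · -- `Z = ∅`: the four functions theorem for the product measure
    rw [hZe, coe_empty, show avoidInS U (S₁ ∪ S₂) (∅ : Set V) = Set.univ from
      Set.eq_univ_of_forall fun ω s _ x hx => hx.elim, Set.inter_univ, coe_union]
    refine prodBernoulli_fourEvents w _ _ _ _ fun a ha b hb => ?_
    obtain ⟨ha1, ha2⟩ := ha
    obtain ⟨hb1, hb2⟩ := hb
    have h := hADU U a b ha1 hb1
    refine ⟨⟨h.1, ?_⟩, h.2⟩
    rw [avoidInS_union]
    exact ⟨fun s hs x hx => (isLowerSet_avoidInS U S₁ ↑X) (Set.inter_subset_left : a ∩ b ⊆ a) ha2 s (mem_inter.mp hs).1 x hx,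
      fun s hs x hx => (isLowerSet_avoidInS U S₂ ↑Y) (Set.inter_subset_right : a ∩ b ⊆ b) hb2 s (mem_inter.mp hs).2 x hx⟩
  set Z := X ∩ Y with hZ
  have hZU : Z ⊆ U := inter_subset_left.trans hX
  by_cases hSZ₁ : (S₁ ∩ Z).Nonempty
  · obtain ⟨s, hs⟩ := hSZ₁
    have h0 : μ.real (localEv U S₁ Φ₁ ∩ avoidInS U S₁ ↑X) = 0 := by
      have : localEv U S₁ Φ₁ ∩ avoidInS U S₁ (↑X : Set V) = ∅ := Set.eq_empty_of_forall_notMem fun ω hω =>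
        hω.2 s (mem_inter.mp hs).1 s (mem_coe.mpr (mem_inter.mp (mem_inter.mp hs).2).1) (Reachable.refl _)
      rw [this, measureReal_empty]
    rw [h0, zero_mul]
    exact mul_nonneg measureReal_nonneg measureReal_nonneg
  by_cases hSZ₂ : (S₂ ∩ Z).Nonempty
  · obtain ⟨s, hs⟩ := hSZ₂
    have h0 : μ.real (localEv U S₂ Φ₂ ∩ avoidInS U S₂ ↑Y) = 0 := by
      have : localEv U S₂ Φ₂ ∩ avoidInS U S₂ (↑Y : Set V) = ∅ := Set.eq_empty_of_forall_notMem fun ω hω =>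
        hω.2 s (mem_inter.mp hs).1 s (mem_coe.mpr (mem_inter.mp (mem_inter.mp hs).2).2) (Reachable.refl _)
      rw [this, measureReal_empty]
    rw [h0, mul_zero]
    exact mul_nonneg measureReal_nonneg measureReal_nonneg
  have hS₁' : S₁ ⊆ U \ Z := fun s hs => mem_sdiff.mpr ⟨hS₁ hs, fun hsZ => hSZ₁ ⟨s, mem_inter.mpr ⟨hs, hsZ⟩⟩⟩
  have hS₂' : S₂ ⊆ U \ Z := fun s hs => mem_sdiff.mpr ⟨hS₂ hs, fun hsZ => hSZ₂ ⟨s, mem_inter.mpr ⟨hs, hsZ⟩⟩⟩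
  have hS₁₂' : S₁ ∩ S₂ ⊆ U \ Z := inter_subset_left.trans hS₁'
  have hS₁₂'' : S₁ ∪ S₂ ⊆ U \ Z := union_subset hS₁' hS₂'
  have hcard : (U \ Z).card < n := by
    have e1 := card_sdiff_add_card_eq_card hZU
    have e2 : 0 < Z.card := card_pos.mpr (nonempty_of_ne_empty hZe)
    omega
  set U' := U \ Z with hU'
  set X' := X \ Z with hX'd
  set Y' := Y \ Z with hY'd
  have hX' : X' ⊆ U' := sdiff_subset_sdiff hX Subset.rfl
  have hY' : Y' ⊆ U' := sdiff_subset_sdiff hY Subset.rfl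
  -- the four functions on the lattice of boundary sets
  set f₁ : Finset V → ℝ := fun T => μ.real (localEv U' S₁ Φ₁ ∩ avoidInS U' S₁ ↑(X' ∪ T)) * piS U Z w T with hf₁
  set f₂ : Finset V → ℝ := fun T => μ.real (localEv U' S₂ Φ₂ ∩ avoidInS U' S₂ ↑(Y' ∪ T)) * piS U Z w T with hf₂
  set f₃ : Finset V → ℝ := fun T => μ.real (localEv U' (S₁ ∪ S₂) Φ₄ ∩ avoidInS U' (S₁ ∪ S₂) ↑T) * piS U Z w T with hf₃
  set f₄ : Finset V → ℝ := fun T =>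
    μ.real (localEv U' (S₁ ∩ S₂) Φ₃ ∩ avoidInS U' (S₁ ∩ S₂) ↑(X' ∪ Y' ∪ T)) * piS U Z w T with hf₄
  have h0₁ : 0 ≤ f₁ := fun T => mul_nonneg measureReal_nonneg (piS_nonneg' w U Z T)
  have h0₂ : 0 ≤ f₂ := fun T => mul_nonneg measureReal_nonneg (piS_nonneg' w U Z T)
  have h0₃ : 0 ≤ f₃ := fun T => mul_nonneg measureReal_nonneg (piS_nonneg' w U Z T)
  have h0₄ : 0 ≤ f₄ := fun T => mul_nonneg measureReal_nonneg (piS_nonneg' w U Z T)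
  have hAD4 : ∀ ⦃A⦄, A ⊆ U' → ∀ ⦃B⦄, B ⊆ U' → f₁ A * f₂ B ≤ f₃ (A ∩ B) * f₄ (A ∪ B) := by
    intro A hA B hB
    have hIH := ih _ hcard U' rfl hS₁' hS₂' (union_subset hX' hA) (union_subset hY' hB)
    have hmono : μ.real (localEv U' (S₁ ∪ S₂) Φ₄ ∩ avoidInS U' (S₁ ∪ S₂) ↑((X' ∪ A) ∩ (Y' ∪ B))) ≤
        μ.real (localEv U' (S₁ ∪ S₂) Φ₄ ∩ avoidInS U' (S₁ ∪ S₂) ↑(A ∩ B)) :=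
      measureReal_mono (Set.inter_subset_inter_right _
        (avoidInS_anti U' (S₁ ∪ S₂) (coe_subset.mpr (inter_subset_inter subset_union_right subset_union_right))))
    have hun : X' ∪ A ∪ (Y' ∪ B) = X' ∪ Y' ∪ (A ∪ B) := by
      ext x; simp only [mem_union]; tauto
    rw [hun] at hIH
    have hprob : μ.real (localEv U' S₁ Φ₁ ∩ avoidInS U' S₁ ↑(X' ∪ A)) * μ.real (localEv U' S₂ Φ₂ ∩ avoidInS U' S₂ ↑(Y' ∪ B)) ≤
        μ.real (localEv U' (S₁ ∪ S₂) Φ₄ ∩ avoidInS U' (S₁ ∪ S₂) ↑(A ∩ B)) *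
          μ.real (localEv U' (S₁ ∩ S₂) Φ₃ ∩ avoidInS U' (S₁ ∩ S₂) ↑(X' ∪ Y' ∪ (A ∪ B))) := by
      rw [mul_comm (μ.real (localEv U' (S₁ ∪ S₂) Φ₄ ∩ _))]
      exact hIH.trans (mul_le_mul_of_nonneg_left hmono measureReal_nonneg)
    have hpi := piS_modular U Z w A B
    calc f₁ A * f₂ B
        = (μ.real (localEv U' S₁ Φ₁ ∩ avoidInS U' S₁ ↑(X' ∪ A)) * μ.real (localEv U' S₂ Φ₂ ∩ avoidInS U' S₂ ↑(Y' ∪ B))) *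
            (piS U Z w A * piS U Z w B) := by simp only [hf₁, hf₂]; ring
      _ ≤ (μ.real (localEv U' (S₁ ∪ S₂) Φ₄ ∩ avoidInS U' (S₁ ∪ S₂) ↑(A ∩ B)) *
            μ.real (localEv U' (S₁ ∩ S₂) Φ₃ ∩ avoidInS U' (S₁ ∩ S₂) ↑(X' ∪ Y' ∪ (A ∪ B)))) *
            (piS U Z w (A ∩ B) * piS U Z w (A ∪ B)) := by
          rw [hpi]
          exact mul_le_mul_of_nonneg_right hprob (mul_nonneg (piS_nonneg' w U Z _) (piS_nonneg' w U Z _))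
      _ = f₃ (A ∩ B) * f₄ (A ∪ B) := by simp only [hf₃, hf₄]; ring
  have h4 := Finset.four_functions_theorem U' h0₁ h0₂ h0₃ h0₄ hAD4 (𝒜 := U'.powerset) (ℬ := U'.powerset) Subset.rfl Subset.rfl
  rw [powerset_infs_powerset_self, powerset_sups_powerset_self] at h4
  -- the four fibre sums
  have key : ∀ {S : Finset V}, S ⊆ U \ Z → ∀ (Φ : (V → Set V) → Prop) (W : Finset V),
      ∑ T ∈ U'.powerset, μ.real (localEv U' S Φ ∩ avoidInS U' S ↑(W ∪ T)) * piS U Z w T =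
        μ.real (localEv U S Φ ∩ avoidInS U S (↑W ∪ ↑Z)) := by
    intro S hS Φ W
    calc ∑ T ∈ U'.powerset, μ.real (localEv U' S Φ ∩ avoidInS U' S ↑(W ∪ T)) * piS U Z w T
        = ∑ T ∈ U'.powerset, μ.real (localEv U S Φ ∩ avoidInS U S (↑W ∪ ↑Z) ∩ {ω | bS U Z ω = T}) :=
          sum_congr rfl fun T hT' => by rw [real_localEv_fibre w U Z hZU hS Φ ↑W (mem_powerset.mp hT'), coe_union]
      _ = μ.real (localEv U S Φ ∩ avoidInS U S (↑W ∪ ↑Z)) := sum_fibre' w U Z _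
  have s1 : ∑ T ∈ U'.powerset, f₁ T = μ.real (localEv U S₁ Φ₁ ∩ avoidInS U S₁ ↑X) := by
    rw [hf₁, key hS₁' Φ₁ X', ← coe_union, hX'd, sdiff_union_of_subset (inter_subset_left : Z ⊆ X)]
  have s2 : ∑ T ∈ U'.powerset, f₂ T = μ.real (localEv U S₂ Φ₂ ∩ avoidInS U S₂ ↑Y) := by
    rw [hf₂, key hS₂' Φ₂ Y', ← coe_union, hY'd, sdiff_union_of_subset (inter_subset_right : Z ⊆ Y)]
  have s3 : ∑ T ∈ U'.powerset, f₃ T = μ.real (localEv U (S₁ ∪ S₂) Φ₄ ∩ avoidInS U (S₁ ∪ S₂) ↑(X ∩ Y)) := by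
    have := key hS₁₂'' Φ₄ ∅
    simp only [empty_union] at this
    rw [hf₃, this, coe_empty, Set.empty_union]
  have s4 : ∑ T ∈ U'.powerset, f₄ T = μ.real (localEv U (S₁ ∩ S₂) Φ₃ ∩ avoidInS U (S₁ ∩ S₂) ↑(X ∪ Y)) := by
    have hXY : X' ∪ Y' ∪ Z = X ∪ Y := by
      ext x; simp only [hX'd, hY'd, hZ, mem_union, mem_sdiff, mem_inter]; tauto
    rw [hf₄, key hS₁₂' Φ₃ (X' ∪ Y'), ← coe_union, hXY]
  rw [s1, s2, s3, s4, mul_comm (μ.real (localEv U (S₁ ∪ S₂) Φ₄ ∩ _))] at h4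
  exact h4

/-- **THEOREM (Ahlswede–Daykin four events under avoidance conditioning; "cross-conditioning exchange").**
For Bernoulli bond percolation on a finite weighted graph (`μ = prodBernoulli w`), finite source sets `S₁, S₂`, predicates
`Φ₁, Φ₂, Φ₃, Φ₄` on reach profiles (`Consts.reachOf S ω : v ↦ {u | v ∈ S ∧ v ↔ u}`) such that for all configurations
`Φ₁(reachOf S₁ ω) ∧ Φ₂(reachOf S₂ ω') ⟹ Φ₃(reachOf (S₁∩S₂) (ω ∩ ω')) ∧ Φ₄(reachOf (S₁∪S₂) (ω ∪ ω'))`, and vertex sets `X, Y`: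
`μ(Φ₁, S₁ ↮ X) · μ(Φ₂, S₂ ↮ Y) ≤ μ(Φ₃, S₁∩S₂ ↮ X∪Y) · μ(Φ₄, S₁∪S₂ ↮ X∩Y)`, `{S ↮ W} = {∀ s ∈ S, ∀ x ∈ W, s ↮ x}`.
The avoidance of `X ∩ Y` by ALL sources survives on the join side although `ω ∪ ω'` need not avoid it.
[cite: VandenbergHaggstromKahn2005, Thm. 1.1 and its proof (pp. 3–5) — generalisation to source-local events, derived here] -/
theorem localEv_fourEvents (S₁ S₂ : Finset V) {Φ₁ Φ₂ Φ₃ Φ₄ : (V → Set V) → Prop}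
    (hAD : ∀ ω ω' : BondConfig V, Φ₁ (reachOf S₁ ω) → Φ₂ (reachOf S₂ ω') →
      Φ₃ (reachOf (S₁ ∩ S₂) (ω ∩ ω')) ∧ Φ₄ (reachOf (S₁ ∪ S₂) (ω ∪ ω'))) (X Y : Set V) :
    (prodBernoulli w).real ({ω | Φ₁ (reachOf S₁ ω)} ∩ {ω | ∀ s ∈ S₁, ∀ x ∈ X, ω ∉ openConn s x}) *
        (prodBernoulli w).real ({ω | Φ₂ (reachOf S₂ ω)} ∩ {ω | ∀ s ∈ S₂, ∀ x ∈ Y, ω ∉ openConn s x}) ≤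
      (prodBernoulli w).real ({ω | Φ₃ (reachOf (S₁ ∩ S₂) ω)} ∩ {ω | ∀ s ∈ S₁ ∩ S₂, ∀ x ∈ X ∪ Y, ω ∉ openConn s x}) *
        (prodBernoulli w).real ({ω | Φ₄ (reachOf (S₁ ∪ S₂) ω)} ∩ {ω | ∀ s ∈ S₁ ∪ S₂, ∀ x ∈ X ∩ Y, ω ∉ openConn s x}) := by
  classical
  have hE : edgesIn (Finset.univ : Finset V) = Set.univ := Set.eq_univ_of_forall fun e v _ => mem_univ v
  have hQ : ∀ (S : Finset V) (Φ : (V → Set V) → Prop), localEv Finset.univ S Φ = {ω : BondConfig V | Φ (reachOf S ω)} :=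
    fun S Φ => by ext ω; simp only [localEv, hE, Set.inter_univ, Set.mem_setOf_eq]
  have h := localEv_fourEvents_aux w hAD _ Finset.univ rfl (subset_univ S₁) (subset_univ S₂) (X := X.toFinite.toFinset)
    (Y := Y.toFinite.toFinset) (subset_univ _) (subset_univ _)
  simpa only [avoidInS_univ, hQ, coe_inter, coe_union, Set.Finite.coe_toFinset] using h

end Consts

end Summit.CriticalPhenomena.PercolationContinuityZ3.Theorems

end
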